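import Literature.Analysis.FluidPDE.CKNMorreyDualEstimate
import Literature.Analysis.FluidPDE.CKNMorreyRepresentation
import Literature.Analysis.FluidPDE.CKNStep3Extraction
import Literature.Analysis.FluidPDE.CKNStep3TermBounds
import HarnessLib

/-!
# The representation (13.50)–(13.52) of Lemarié-Rieusset 2016, §13.9 Step 3 — discharged

Analysis/FluidPDE proofs file **discharging the named fact
`Literature.Analysis.FluidPDE.LemarieRieusset2016.step3_velocityBound`**
(`CKNMorreyRepresentation.lean`; P. G. Lemarié-Rieusset, *The Navier–Stokes Problem in the 21st
Century*, CRC Press 2016, §13.9 Step 3, (13.50)–(13.52), pp. 474–476: a.e. on `Q₃ = Q_{r₃}(z₀)`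
the velocity of a suitable solution is dominated by parabolic Riesz potentials of Morrey data,
`|u| ≤ C (𝓘₂(1_{Q₂}|u|) + 𝓘₂(1_{Q₂}|f|) + 𝓘₂(1_{Q₂}|u||∇ ⊗ u|) + 𝓘₁(1_{Q₂}|u|) + 𝓘₂(Γ) + 𝓘₂(E)
  + 𝓘₁(1_{Q₂}|u|²))`, for some `Γ` vanishing off `Q₂` with `1_{Q₂}Γ ∈ ℳ₂^{q₀,5q₀/2}` and some
`E` with the conditional Morrey bounds of p. 476).

## The proof (duality route)

The printed proof obtains (13.52) from the heat-kernel representation of `v = φu` and the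
pressure decomposition (13.51) (Oseen kernel, Calderón commutator). Here the pointwise bound is
extracted from the **dual pairing bound** already in the tree,
`LemarieRieusset2016.dual_pairing_bound` (`CKNMorreyDualEstimate.lean`: for every scalar test
function `θ` on `Q₃` and every `‖c‖ ≤ 1`,
`|∫ θ ⟪u, c⟫| ≤ C₀ ∫|θ| + C ∫ (𝓘₂(1_{Q₂}|f|) + 𝓘₁(1_{Q₂}|u|²)) |θ|`), by the extraction lemma
`FunctionSpaces.ae_enorm_le_of_forall_test` (`CKNStep3Extraction.lean`: a tested bound
`|∫_S E Ψ| ≤ ∫ |Ψ| W` for all test functions supported in the open set `S`, with `W` locally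
integrable on `S`, gives `|E| ≤ W` a.e. on `S`). Applied to the three components `⟪u, eₖ⟫` this
yields, a.e. on `Q₃`,
`|u| ≤ Σₖ |⟪u, eₖ⟫| ≤ Σₖ C₀ₖ + (Σₖ Cₖ) (𝓘₂(1_{Q₂}|f|) + 𝓘₁(1_{Q₂}|u|²))`.
The constant is absorbed by the slot `𝓘₂(Γ)` of (13.52) with the admissible choice
`Γ = 1_{Q₂}` (measurable, vanishing off `Q₂`, and `1_{Q₂} ∈ ℳ₂^{q₀,5q₀/2}` since
`5(1 - q₀/(5q₀/2)) = 3 ∈ [0, 5]`, `isParabolicMorreyOn_one_indicator`), because `𝓘₂(1_{Q₂})` is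
bounded below on `Q₃` by a positive constant (`exists_pos_le_parabolicRieszPotential_indicator`,
`CKNStep3TermBounds.lean`); in print `γ⃗` is likewise the lower-order cut-off part of the
pressure. The commutator slot is not needed: `E = 0` (trivially in every Morrey class). The
local integrability of the majorant on `Q₃` required by the extraction is
`lintegral_cylinder_parabolicRieszPotential_le` (`CKNStep3TermBounds.lean`) together with the
finiteness of `∫_{Q₂} |f|` and `∫_{Q₂} |u|²`, read off the Morrey hypotheses on the cylinder `Q₂`
itself (`|f| ≤ 1 + |f|^{10/7}`, `|u|² ≤ 1 + |u|³`).

* `LemarieRieusset2016.step3_velocityBound_holds : step3_velocityBound`.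

With `lemma13_5_step_of_velocityBound` / `lemma13_5_of_velocityBound`
(`CKNMorreyBootstrapProofs.lean`) this also closes the printed (primal) reduction chain of
Lemma 13.5; the lemma itself is already a theorem of the tree (`lemma13_5_holds`,
`CKNMorreyBootstrapDual.lean`).

Theorem-only proofs module: no definition of data, no named fact, no `sorry`.

## References

* P. G. Lemarié-Rieusset, *The Navier–Stokes Problem in the 21st Century*, CRC Press (2016),
  §13.9 Step 3: (13.50)–(13.52) (pp. 474–475), proof of Lemma 13.5 (pp. 475–477).
  [LemarieRieusset2016]
-/

noncomputable section

open MeasureTheory Set Function Filter TopologicalSpace Metric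
open scoped Topology RealInnerProductSpace ENNReal NNReal

namespace Literature.Analysis.FluidPDE

/-! ### Tools -/

/-- **`|v| ≤ ∑ₖ |⟪v, eₖ⟫|`** for the standard frame of `ℝ³` (`v = ∑ₖ ⟪eₖ, v⟫ eₖ` and the triangle
inequality), in `ℝ≥0∞`. [folklore] -/
theorem enorm_le_sum_enorm_inner (v : EuclideanSpace ℝ (Fin 3)) :
    ‖v‖ₑ ≤ ∑ k : Fin 3, ‖(⟪v, EuclideanSpace.basisFun (Fin 3) ℝ k⟫ : ℝ)‖ₑ := by
  set b := EuclideanSpace.basisFun (Fin 3) ℝ with hb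
  have hnorm : ‖v‖ ≤ ∑ k, ‖(⟪v, b k⟫ : ℝ)‖ := by
    conv_lhs => rw [← b.sum_repr' v]
    refine (norm_sum_le _ _).trans (le_of_eq (Finset.sum_congr rfl fun k _ => ?_))
    rw [norm_smul, b.orthonormal.1 k, mul_one, real_inner_comm]
  calc ‖v‖ₑ = ENNReal.ofReal ‖v‖ := (ofReal_norm v).symm
    _ ≤ ENNReal.ofReal (∑ k, ‖(⟪v, b k⟫ : ℝ)‖) := ENNReal.ofReal_le_ofReal hnorm
    _ = ∑ k, ENNReal.ofReal ‖(⟪v, b k⟫ : ℝ)‖ :=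
        ENNReal.ofReal_sum_of_nonneg fun k _ => norm_nonneg _
    _ = ∑ k, ‖(⟪v, b k⟫ : ℝ)‖ₑ := Finset.sum_congr rfl fun k _ => ofReal_norm _

/-- `a² ≤ 1 + a³` in `ℝ≥0∞` (real exponent `3`). [folklore] -/
theorem ennreal_mul_self_le_one_add_rpow_three (a : ℝ≥0∞) : a * a ≤ 1 + a ^ (3 : ℝ) := by
  rcases le_or_gt a 1 with ha | ha
  · calc a * a ≤ 1 * 1 := mul_le_mul' ha ha
      _ = 1 := one_mul 1
      _ ≤ 1 + a ^ (3 : ℝ) := le_self_add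
  · have h3 : a ^ (3 : ℝ) = a * a * a := by
      rw [show (3 : ℝ) = ((3 : ℕ) : ℝ) by norm_num, ENNReal.rpow_natCast, pow_succ, pow_two]
    calc a * a = a * a * 1 := (mul_one _).symm
      _ ≤ a * a * a := mul_le_mul' le_rfl ha.le
      _ = a ^ (3 : ℝ) := h3.symm
      _ ≤ 1 + a ^ (3 : ℝ) := le_add_self

/-- The final bookkeeping of the discharge: if `v ≤ a + b (X₂ + X₇)` and `a ≤ a c X₅`, then
`v ≤ (a c + b) (X₁ + X₂ + X₃ + X₄ + X₅ + X₆ + X₇)` in `ℝ≥0∞`. [folklore] -/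
theorem le_seven_terms_of_le {v a b c X₁ X₂ X₃ X₄ X₅ X₆ X₇ : ℝ≥0∞}
    (h1 : v ≤ a + b * (X₂ + X₇)) (h2 : a ≤ a * c * X₅) :
    v ≤ (a * c + b) * (X₁ + X₂ + X₃ + X₄ + X₅ + X₆ + X₇) := by
  have hX₅ : X₅ ≤ X₁ + X₂ + X₃ + X₄ + X₅ + X₆ + X₇ :=
    le_add_right (le_add_right (le_add_left le_rfl))
  have hX₂₇ : X₂ + X₇ ≤ X₁ + X₂ + X₃ + X₄ + X₅ + X₆ + X₇ :=
    add_le_add (le_add_right (le_add_right (le_add_right (le_add_right (le_add_left le_rfl)))))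
      le_rfl
  calc v ≤ a + b * (X₂ + X₇) := h1
    _ ≤ a * c * X₅ + b * (X₂ + X₇) := add_le_add h2 le_rfl
    _ ≤ a * c * (X₁ + X₂ + X₃ + X₄ + X₅ + X₆ + X₇) + b * (X₁ + X₂ + X₃ + X₄ + X₅ + X₆ + X₇) :=
        add_le_add (mul_le_mul' le_rfl hX₅) (mul_le_mul' le_rfl hX₂₇)
    _ = (a * c + b) * (X₁ + X₂ + X₃ + X₄ + X₅ + X₆ + X₇) := (add_mul _ _ _).symm

/-- `L^r(Ω)` functions, `1 ≤ r`, are locally integrable on the open set `Ω ⊆ ℝ × ℝ³` (private copy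
of the tool of `CKNPressureLocalizationProofs.lean`, to keep the imports light). [folklore] -/
private theorem locallyIntegrableOn_of_memLp_restrict_rep {F : Type*} [NormedAddCommGroup F]
    {g : ℝ × EuclideanSpace ℝ (Fin 3) → F} {Ω : Set (ℝ × EuclideanSpace ℝ (Fin 3))}
    (hΩ : IsOpen Ω) {r : ℝ≥0∞} (hr : 1 ≤ r) (hg : MemLp g r (volume.restrict Ω)) :
    LocallyIntegrableOn g Ω volume := by
  rw [locallyIntegrableOn_iff hΩ.isLocallyClosed]
  intro K hKΩ hK
  have h1 : MemLp g r (volume.restrict K) := hg.mono_measure (Measure.restrict_mono hKΩ le_rfl)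
  haveI : IsFiniteMeasure ((volume : Measure (ℝ × EuclideanSpace ℝ (Fin 3))).restrict K) :=
    ⟨by rw [Measure.restrict_apply_univ]; exact hK.measure_lt_top⟩
  exact memLp_one_iff_integrable.1 (h1.mono_exponent hr)

namespace LemarieRieusset2016

/-- **The representation (13.50)–(13.52), proved** (the named statement
`LemarieRieusset2016.step3_velocityBound`; Lemarié-Rieusset 2016, §13.9 Step 3, pp. 474–476):
a.e. on `Q₃`, `|u| ≤ C (𝓘₂(1_{Q₂}|u|) + 𝓘₂(1_{Q₂}|f|) + 𝓘₂(1_{Q₂}|u||∇ ⊗ u|) + 𝓘₁(1_{Q₂}|u|) +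
𝓘₂(Γ) + 𝓘₂(E) + 𝓘₁(1_{Q₂}|u|²))` with `Γ = 1_{Q₂}` (`∈ ℳ₂^{q₀,5q₀/2}`, vanishing off `Q₂`) and
`E = 0`, by the dual pairing bound `dual_pairing_bound`, the extraction
`FunctionSpaces.ae_enorm_le_of_forall_test`, and the lower bound of `𝓘₂(1_{Q₂})` on `Q₃`; see the
module docstring. [cite: LemarieRieusset2016, §13.9 Step 3 (13.50)–(13.52) pp. 474–476] -/
theorem step3_velocityBound_holds : step3_velocityBound := by
  intro ν q₀ τ₀ τ₂ Ω f u p G z₀ r₂ r₃ hν hq₀ _hq₀' _hτ₀ _hτ₂ hr₃ hr₃r₂ hS hΩ hf hu _hG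
  classical
  haveI : (volume : Measure (ℝ × EuclideanSpace ℝ (Fin 3))).IsAddHaarMeasure := by
    rw [Measure.volume_eq_prod]; infer_instance
  -- the two cylinders
  have hr₂ : 0 < r₂ := hr₃.trans hr₃r₂
  set Q₂ : Set (ℝ × EuclideanSpace ℝ (Fin 3)) := FluidPDE.parabolicCylinderCentered r₂ z₀
    with hQ₂_def
  set Q₃ : Set (ℝ × EuclideanSpace ℝ (Fin 3)) := FluidPDE.parabolicCylinderCentered r₃ z₀
    with hQ₃_def
  have hQ₂m : MeasurableSet Q₂ := (FluidPDE.isOpen_parabolicCylinderCentered r₂ z₀).measurableSet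
  have hQ₃o : IsOpen Q₃ := FluidPDE.isOpen_parabolicCylinderCentered r₃ z₀
  -- measurability of the sizes on `Q₂`, and their extensions by zero
  have hum : AEMeasurable (fun w : ℝ × EuclideanSpace ℝ (Fin 3) => ‖u w.1 w.2‖ₑ)
      (volume.restrict Q₂) := hS.aemeasurable_enorm_velocity hΩ
  have hfm : AEMeasurable (fun w : ℝ × EuclideanSpace ℝ (Fin 3) => ‖f w.1 w.2‖ₑ)
      (volume.restrict Q₂) := hS.aemeasurable_enorm_force hΩ
  set Fz : ℝ × EuclideanSpace ℝ (Fin 3) → ℝ≥0∞ := Q₂.indicator fun w => ‖f w.1 w.2‖ₑ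
    with hFz_def
  set U2 : ℝ × EuclideanSpace ℝ (Fin 3) → ℝ≥0∞ :=
    Q₂.indicator fun w => ‖u w.1 w.2‖ₑ * ‖u w.1 w.2‖ₑ with hU2_def
  have hFzm : AEMeasurable Fz volume := (aemeasurable_indicator_iff hQ₂m).2 hfm
  have hU2m : AEMeasurable U2 volume := (aemeasurable_indicator_iff hQ₂m).2 (hum.mul hum)
  have hFz0 : ∀ w, w ∉ FluidPDE.parabolicCylinderCentered r₂ z₀ → Fz w = 0 := fun w hw =>
    indicator_of_notMem hw _
  have hU20 : ∀ w, w ∉ FluidPDE.parabolicCylinderCentered r₂ z₀ → U2 w = 0 := fun w hw =>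
    indicator_of_notMem hw _
  -- the majorant `Ψ = 𝓘₂(1_{Q₂}|f|) + 𝓘₁(1_{Q₂}|u|²)`
  have mΨ₂ : AEMeasurable (parabolicRieszPotential 2 Fz) volume :=
    aemeasurable_parabolicRieszPotential 2 hFzm
  have mΨ₁ : AEMeasurable (parabolicRieszPotential 1 U2) volume :=
    aemeasurable_parabolicRieszPotential 1 hU2m
  set Ψ : ℝ × EuclideanSpace ℝ (Fin 3) → ℝ≥0∞ := fun w =>
    parabolicRieszPotential 2 Fz w + parabolicRieszPotential 1 U2 w with hΨ_def
  have mΨ : AEMeasurable Ψ volume := mΨ₂.add mΨ₁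
  /- ### `∫ 1_{Q₂}|f| < ∞`, `∫ 1_{Q₂}|u|² < ∞` (from the Morrey hypotheses on the cylinder `Q₂`
  itself), hence `Ψ` is integrable on `Q₃` -/
  have hQ₂self : FluidPDE.parabolicCylinderCentered r₂ z₀ ∩ Q₂ = Q₂ := inter_self _
  have hvolQ₂ : volume Q₂ < ∞ := volume_parabolicCylinderCentered_lt_top r₂ z₀
  have hFzfin : ∫⁻ w, Fz w < ∞ := by
    obtain ⟨M, hM⟩ := hf
    have h := hM z₀ r₂ hr₂
    rw [hQ₂self] at h
    rw [hFz_def, lintegral_indicator hQ₂m]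
    -- `a ≤ 1 + a^{10/7}` (`a ≤ 1`, or `a = a¹ ≤ a^{10/7}`)
    have hle : ∀ a : ℝ≥0∞, a ≤ 1 + a ^ (10 / 7 : ℝ) := fun a => by
      rcases le_or_gt a 1 with ha | ha
      · exact ha.trans le_self_add
      · calc a = a ^ (1 : ℝ) := (ENNReal.rpow_one a).symm
          _ ≤ a ^ (10 / 7 : ℝ) := ENNReal.rpow_le_rpow_of_exponent_le ha.le (by norm_num)
          _ ≤ 1 + a ^ (10 / 7 : ℝ) := le_add_self
    calc ∫⁻ w in Q₂, ‖f w.1 w.2‖ₑ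
        ≤ ∫⁻ w in Q₂, (1 + ‖f w.1 w.2‖ₑ ^ (10 / 7 : ℝ)) := lintegral_mono fun w => hle _
      _ = (∫⁻ _ in Q₂, (1 : ℝ≥0∞)) + ∫⁻ w in Q₂, ‖f w.1 w.2‖ₑ ^ (10 / 7 : ℝ) :=
          lintegral_add_left measurable_const _
      _ < ∞ := by
          rw [setLIntegral_const, one_mul]
          exact ENNReal.add_lt_top.2
            ⟨hvolQ₂, h.trans_lt (ENNReal.mul_lt_top ENNReal.coe_lt_top ENNReal.ofReal_lt_top)⟩
  have hU2fin : ∫⁻ w, U2 w < ∞ := by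
    obtain ⟨M, hM⟩ := hu
    have h := hM z₀ r₂ hr₂
    rw [hQ₂self] at h
    rw [hU2_def, lintegral_indicator hQ₂m]
    calc ∫⁻ w in Q₂, ‖u w.1 w.2‖ₑ * ‖u w.1 w.2‖ₑ
        ≤ ∫⁻ w in Q₂, (1 + ‖u w.1 w.2‖ₑ ^ (3 : ℝ)) :=
          lintegral_mono fun w => ennreal_mul_self_le_one_add_rpow_three _
      _ = (∫⁻ _ in Q₂, (1 : ℝ≥0∞)) + ∫⁻ w in Q₂, ‖u w.1 w.2‖ₑ ^ (3 : ℝ) :=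
          lintegral_add_left measurable_const _
      _ < ∞ := by
          rw [setLIntegral_const, one_mul]
          exact ENNReal.add_lt_top.2
            ⟨hvolQ₂, h.trans_lt (ENNReal.mul_lt_top ENNReal.coe_lt_top ENNReal.ofReal_lt_top)⟩
  obtain ⟨K₂, hK₂, hI₂⟩ := lintegral_cylinder_parabolicRieszPotential_le (z₀ := z₀) hr₃ hr₃r₂.le
    (α := 2) (by norm_num) (by norm_num) hFzm hFz0
  obtain ⟨K₁, hK₁, hI₁⟩ := lintegral_cylinder_parabolicRieszPotential_le (z₀ := z₀) hr₃ hr₃r₂.le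
    (α := 1) (by norm_num) (by norm_num) hU2m hU20
  have hΨQ₃ : ∫⁻ z in Q₃, Ψ z < ∞ := by
    rw [hΨ_def, lintegral_add_left' mΨ₂.restrict]
    exact ENNReal.add_lt_top.2 ⟨hI₂.trans_lt (ENNReal.mul_lt_top hK₂.lt_top hFzfin),
      hI₁.trans_lt (ENNReal.mul_lt_top hK₁.lt_top hU2fin)⟩
  /- ### the dual pairing bounds for the standard frame -/
  have hfloc : LocallyIntegrableOn (uncurry f) (Ω : Set (ℝ × EuclideanSpace ℝ (Fin 3))) volume :=
    locallyIntegrableOn_of_memLp_restrict_rep Ω.isOpen (ENNReal.one_le_ofReal.2 (by norm_num))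
      hS.force_memLp
  have hdivf : ∀ φ' : ℝ → EuclideanSpace ℝ (Fin 3) → ℝ, IsSpaceTimeTestOn Ω φ' →
      ∫ z in (Ω : Set (ℝ × EuclideanSpace ℝ (Fin 3))), ⟪f z.1 z.2, gradient (φ' z.1) z.2⟫ = 0 :=
    fun φ' hφ' => setIntegral_inner_gradient_eq_zero_of_iterated hfloc hS.divFree_force hφ'
  set b : OrthonormalBasis (Fin 3) ℝ (EuclideanSpace ℝ (Fin 3)) := EuclideanSpace.basisFun (Fin 3) ℝ
    with hb_def
  have hb1 : ∀ k, ‖b k‖ ≤ 1 := fun k => (b.orthonormal.1 k).le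
  have Hex : ∀ k : Fin 3, ∃ C₀ C : ℝ≥0, ∀ θ : ℝ → EuclideanSpace ℝ (Fin 3) → ℝ,
      IsSpaceTimeTestOn (FluidPDE.parabolicCylinderCenteredOpens r₃ z₀) θ →
      ‖∫ z : ℝ × EuclideanSpace ℝ (Fin 3), θ z.1 z.2 * ⟪u z.1 z.2, b k⟫‖ₑ ≤
        (C₀ : ℝ≥0∞) * (∫⁻ z : ℝ × EuclideanSpace ℝ (Fin 3), ‖θ z.1 z.2‖ₑ) +
        (C : ℝ≥0∞) * ∫⁻ z : ℝ × EuclideanSpace ℝ (Fin 3), Ψ z * ‖θ z.1 z.2‖ₑ := fun k =>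
    dual_pairing_bound hS.solution hν hfloc hdivf hΩ hr₃ hr₃r₂ (b k) (hb1 k)
  choose C₀ C HC using Hex
  /- ### integrability of `u` on `Q₃` (through the closed box of radius `r₃`, inside `Q₂ ⊆ Ω`) -/
  set Kbox : Set (ℝ × EuclideanSpace ℝ (Fin 3)) :=
    Icc (z₀.1 - r₃ ^ 2) (z₀.1 + r₃ ^ 2) ×ˢ closedBall z₀.2 r₃ with hKbox_def
  have hKc : IsCompact Kbox := isCompact_Icc.prod (isCompact_closedBall _ _)
  have hKΩ : Kbox ⊆ (Ω : Set (ℝ × EuclideanSpace ℝ (Fin 3))) := by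
    refine Subset.trans (fun w hw => ?_) hΩ
    obtain ⟨h1, h2⟩ := hw
    rw [mem_Icc] at h1
    rw [mem_closedBall] at h2
    have hsq : r₃ ^ 2 < r₂ ^ 2 := by nlinarith
    rw [FluidPDE.mem_parabolicCylinderCentered]
    exact ⟨⟨by linarith, by linarith⟩, lt_of_le_of_lt h2 hr₃r₂⟩
  have hQ₃K : Q₃ ⊆ Kbox := parabolicCylinderCentered_subset_closedCylinder r₃ z₀
  have iu : IntegrableOn (uncurry u) Q₃ volume :=
    (hS.solution.1.integrableOn_compact_subset hKΩ hKc).mono_set hQ₃K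
  /- ### the pointwise bound for each component, by extraction from the tested bound -/
  have hcomp : ∀ k : Fin 3, ∀ᵐ z ∂(volume.restrict Q₃),
      ‖(⟪u z.1 z.2, b k⟫ : ℝ)‖ₑ ≤ (C₀ k : ℝ≥0∞) + (C k : ℝ≥0∞) * Ψ z := by
    intro k
    have hE : IntegrableOn (fun w : ℝ × EuclideanSpace ℝ (Fin 3) => ⟪u w.1 w.2, b k⟫) Q₃ volume :=
      iu.inner_const (b k)
    have hW : AEMeasurable (fun z => (C₀ k : ℝ≥0∞) + (C k : ℝ≥0∞) * Ψ z) volume :=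
      aemeasurable_const.add (mΨ.const_mul _)
    have hWint : ∀ K : Set (ℝ × EuclideanSpace ℝ (Fin 3)), IsCompact K → K ⊆ Q₃ →
        ∫⁻ x in K, ((C₀ k : ℝ≥0∞) + (C k : ℝ≥0∞) * Ψ x) < ∞ := by
      intro K hK hKQ₃
      rw [lintegral_add_left measurable_const, setLIntegral_const,
        lintegral_const_mul'' _ mΨ.restrict]
      exact ENNReal.add_lt_top.2 ⟨ENNReal.mul_lt_top ENNReal.coe_lt_top hK.measure_lt_top,
        ENNReal.mul_lt_top ENNReal.coe_lt_top ((lintegral_mono_set hKQ₃).trans_lt hΨQ₃)⟩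
    have htest : ∀ Φ : ℝ × EuclideanSpace ℝ (Fin 3) → ℝ, ContDiff ℝ (⊤ : ℕ∞) Φ →
        HasCompactSupport Φ → tsupport Φ ⊆ Q₃ →
        ENNReal.ofReal |∫ x in Q₃, ⟪u x.1 x.2, b k⟫ * Φ x| ≤
          ∫⁻ x, ‖Φ x‖ₑ * ((C₀ k : ℝ≥0∞) + (C k : ℝ≥0∞) * Ψ x) := by
      intro Φ hΦ1 hΦ2 hΦ3
      -- `Φ` as a space–time test function on `Q₃`
      set θ : ℝ → EuclideanSpace ℝ (Fin 3) → ℝ := fun t x => Φ (t, x) with hθ_def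
      have huθ : uncurry θ = Φ := by funext w; rfl
      have hθ : IsSpaceTimeTestOn (FluidPDE.parabolicCylinderCenteredOpens r₃ z₀) θ := by
        refine ⟨?_, ?_, ?_⟩
        · rw [huθ]; exact hΦ1
        · rw [huθ]; exact hΦ2
        · rw [huθ]; exact hΦ3
      have hΦ0 : ∀ w, w ∉ Q₃ → Φ w = 0 := fun w hw =>
        image_eq_zero_of_notMem_tsupport fun h => hw (hΦ3 h)
      -- the pairing
      have hpair : ∫ w in Q₃, ⟪u w.1 w.2, b k⟫ * Φ w =
          ∫ w : ℝ × EuclideanSpace ℝ (Fin 3), θ w.1 w.2 * ⟪u w.1 w.2, b k⟫ := by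
        rw [setIntegral_eq_integral_of_forall_compl_eq_zero fun w hw => by
          rw [hΦ0 w hw, mul_zero]]
        exact integral_congr_ae (Eventually.of_forall fun w => mul_comm _ _)
      have hθΦ : ∀ w : ℝ × EuclideanSpace ℝ (Fin 3), ‖θ w.1 w.2‖ₑ = ‖Φ w‖ₑ := fun w => rfl
      have hΦm : Measurable fun w => ‖Φ w‖ₑ := hΦ1.continuous.measurable.enorm
      rw [hpair, ← Real.enorm_eq_ofReal_abs]
      refine (HC k θ hθ).trans (le_of_eq ?_)
      simp_rw [hθΦ]
      calc (C₀ k : ℝ≥0∞) * (∫⁻ z, ‖Φ z‖ₑ) + (C k : ℝ≥0∞) * ∫⁻ z, Ψ z * ‖Φ z‖ₑ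
          = (∫⁻ z, ‖Φ z‖ₑ * (C₀ k : ℝ≥0∞)) + ∫⁻ z, ‖Φ z‖ₑ * ((C k : ℝ≥0∞) * Ψ z) := by
            rw [← lintegral_const_mul' _ _ ENNReal.coe_ne_top,
              ← lintegral_const_mul' _ _ ENNReal.coe_ne_top]
            congr 1
            · exact lintegral_congr fun z => mul_comm _ _
            · exact lintegral_congr fun z => by ring
        _ = ∫⁻ z, ‖Φ z‖ₑ * ((C₀ k : ℝ≥0∞) + (C k : ℝ≥0∞) * Ψ z) := by
            rw [← lintegral_add_left (hΦm.mul_const _)]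
            exact lintegral_congr fun z => (mul_add _ _ _).symm
    exact FunctionSpaces.ae_enorm_le_of_forall_test hQ₃o hE hW hWint htest
  /- ### the witnesses and the bound -/
  obtain ⟨c₀, hc₀0, hc₀t, hc₀⟩ :=
    exists_pos_le_parabolicRieszPotential_indicator (z₀ := z₀) hr₃ hr₃r₂.le
  have hall : ∀ᵐ z ∂(volume.restrict Q₃), ∀ k, ‖(⟪u z.1 z.2, b k⟫ : ℝ)‖ₑ ≤
      (C₀ k : ℝ≥0∞) + (C k : ℝ≥0∞) * Ψ z := ae_all_iff.2 hcomp
  refine ⟨(∑ k, C₀ k) * (c₀⁻¹).toNNReal + ∑ k, C k, Q₂.indicator fun _ => 1, fun _ => 0,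
    (aemeasurable_indicator_iff hQ₂m).2 aemeasurable_const, aemeasurable_const,
    fun w hw => indicator_of_notMem hw _, ?_, ?_, ?_⟩
  · -- `1_{Q₂} ∈ ℳ₂^{q₀,5q₀/2}`: the exponent is `5(1 - 2/5) = 3`
    have hq0 : 0 < q₀ := by linarith
    have hκ : q₀ / (5 * q₀ / 2) = 2 / 5 := by
      rw [div_eq_iff (ne_of_gt (by positivity))]; ring
    refine isParabolicMorreyOn_one_indicator hr₂ hq0 ?_ ?_ <;> rw [hκ] <;> norm_num
  · -- `E = 0` lies in every Morrey class
    intro γ _ _ _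
    refine ⟨0, fun z r _ => ?_⟩
    simp [ENNReal.zero_rpow_of_pos (show (0 : ℝ) < 3 / 2 by norm_num)]
  · -- the domination a.e. on `Q₃`
    filter_upwards [hall, ae_restrict_mem hQ₃o.measurableSet] with z hz hzQ₃
    have h1 : ‖u z.1 z.2‖ₑ ≤ ((∑ k, C₀ k : ℝ≥0) : ℝ≥0∞) + ((∑ k, C k : ℝ≥0) : ℝ≥0∞) *
        (parabolicRieszPotential 2 Fz z + parabolicRieszPotential 1 U2 z) := by
      calc ‖u z.1 z.2‖ₑ ≤ ∑ k, ‖(⟪u z.1 z.2, b k⟫ : ℝ)‖ₑ := enorm_le_sum_enorm_inner _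
        _ ≤ ∑ k, ((C₀ k : ℝ≥0∞) + (C k : ℝ≥0∞) * Ψ z) := Finset.sum_le_sum fun k _ => hz k
        _ = ((∑ k, C₀ k : ℝ≥0) : ℝ≥0∞) + ((∑ k, C k : ℝ≥0) : ℝ≥0∞) * Ψ z := by
            rw [Finset.sum_add_distrib, ← Finset.sum_mul, ENNReal.ofNNReal_finsetSum,
              ENNReal.ofNNReal_finsetSum]
    have hci : (((c₀⁻¹).toNNReal : ℝ≥0) : ℝ≥0∞) = c₀⁻¹ :=
      ENNReal.coe_toNNReal (ENNReal.inv_ne_top.2 hc₀0)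
    have h2 : ((∑ k, C₀ k : ℝ≥0) : ℝ≥0∞) ≤ ((∑ k, C₀ k : ℝ≥0) : ℝ≥0∞) * ((c₀⁻¹).toNNReal : ℝ≥0∞) *
        parabolicRieszPotential 2 (Q₂.indicator fun _ => (1 : ℝ≥0∞)) z := by
      rw [hci, mul_assoc]
      calc ((∑ k, C₀ k : ℝ≥0) : ℝ≥0∞) = ((∑ k, C₀ k : ℝ≥0) : ℝ≥0∞) * 1 := (mul_one _).symm
        _ ≤ ((∑ k, C₀ k : ℝ≥0) : ℝ≥0∞) *
            (c₀⁻¹ * parabolicRieszPotential 2 (Q₂.indicator fun _ => (1 : ℝ≥0∞)) z) := by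
            refine mul_le_mul' le_rfl ?_
            calc (1 : ℝ≥0∞) = c₀⁻¹ * c₀ := (ENNReal.inv_mul_cancel hc₀0 hc₀t).symm
              _ ≤ c₀⁻¹ * parabolicRieszPotential 2 (Q₂.indicator fun _ => (1 : ℝ≥0∞)) z :=
                  mul_le_mul' le_rfl (hc₀ z hzQ₃)
    push_cast
    exact le_seven_terms_of_le h1 h2

end LemarieRieusset2016

end Literature.Analysis.FluidPDE
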